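import Summits.BirchSwinnertonDyer.BirchSwinnertonDyer.Theorems.EisensteinPrimesSplitMultLambdaLE
import Literature.NumberTheory.EllipticCurves.IwasawaSelmerIsTorsionProofs
import Literature.NumberTheory.EllipticCurves.IwasawaAlgebraMuAdditiveProofs
import HarnessLib

/-!
# Crux 4 `BSDpOnCellC` (stmt-BirchSwinnertonDyer-19034), line b1 — the SPLIT conjunct of the wall `stub_imprimitiveCount`:
# the imprimitivity set ONLY MATTERS OFF `p` — transfer of every Selmer object of the V21 index road (Castella's `Sel_𝔭^S`,
# its dual `X_ac^S` as a `Λ`-MODULE, Greenberg–Vatsal's `S^S_M(K_∞)` and its dual data) along two sets of places that agree at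
# the places not dividing `p`

Cell `bsd-eis` (run/shared/lean/pub/bsd-eis/), width seat `bsd-line-x2-p2` gen 10 (`--supports -19034`, closes nothing; skeleton of
record b1 v12 sha256 155e218d… UNCHANGED, W-79). Sequel of `…SplitMultLambdaLE` (this seat).

WHY. The x1 cell's producers, re-used verbatim by this seat's split files, take the imprimitivity set in the convention
`w ∈ Sf ↔ N_W ∈ w`; at a multiplicative prime `p ∣ N` that set CONTAINS the two places `v, v̄` over `p`, whereas line b1's wall quantifies
`Sf` by `w ∈ Sf ↔ (N_W ∈ w ∧ p ∉ w)` (Keller–Yin §5.1: `S = Σ ∖ {v, v̄, ∞}`). No Selmer object of the road sees the difference: Castella's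
`Sel_𝔭^S(K_∞, ·)` (`AcSelmer.selmerOver` / `selmerAc`), Greenberg–Vatsal's `unramifiedOutside`, `datumSelmer`, `datumStrictSelmer` all impose
their «outside `S`» condition ONLY at places `w ∤ p` (the places over `p` carry their own data `L`). This file proves the transfers (the
restatement of this seat's `SplitMultLambdaLE.lambdaInvariant_add_le_of_split` in line b1's currency is the sequel file):

* §1 `…_congr_offP` — if `∀ w, p ∉ w → (w ∈ S₀ ↔ w ∈ S₁)` then `unramifiedOutside`, `datumSelmer`, `datumStrictSelmer`, `selmerOver`,
  `selmerAc` for `S₀` and `S₁` are EQUAL subgroups;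
* §2 `prop_datumDualData_congr` — along an equality `datumSelmerInfty κ M L S₀ = datumSelmerInfty κ M L S₁` every GV dual datum for `S₀` IS
  one for `S₁` with the same `Λ`-module (g8's transfer pattern `prop_datumDualData_of_forall_grDualData`);
* §3 `nonempty_linearEquiv_xAc_of_selmerAc_eq` — along `selmerAc … S₀ = selmerAc … S₁` the duals `X_ac^{S₀}`, `X_ac^{S₁}` are `Λ`-LINEARLY
  isomorphic (precomposition with the identity of the group; `Λ`-linearity from the `evalT` formula of the `IsLocNil` module structure,
  the two `T`-operators `conj_γ − 1` being intertwined), whence `Module.Finite`, `IsTorsion`, `μ`, `λ` transfer (`xAc_invariants_congr`);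
* the sequel `EisensteinPrimesSplitMultLambdaLEOffP` uses §1–§3 to restate `SplitMultLambdaLE.lambdaInvariant_add_le_of_split` with EVERY
  object over line b1's `Sf = {w : N ∈ w, p ∉ w}` (the wall's binder).

HONEST FRAMING: helper theorems only (0 defs, 0 named facts introduced, 0 sorry); UNCONDITIONAL (pure transfer statements); closes no
stub; no summit statement / BSD / MC / IMC is proved here; 0 cells / labels / tiers move.

References: [KellerYin2024] §5.1 (TeX L1725–1735: `S = Σ ∖ {v, v̄, ∞}`), Thm. 1.4.1 (iii), Rem. 1.4.2 (arXiv:2402.12781v2); [Castella2018]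
Def. 2.2 and §2.2 (arXiv:1704.06608 p. 5); [GreenbergVatsal2000] §2 pp. 15–17, 20, 23; [GreenbergLNM1716] §1 (after Conj. 1.3); [Lang1990] Ch. 5 §1;
[Washington1997] §13.2.
-/

set_option autoImplicit false
-- the route's Theorems namespace repeats the summit name by design (D-0017 nested layout)
set_option linter.dupNamespace false

noncomputable section

open scoped Classical

namespace Summit.BirchSwinnertonDyer.BirchSwinnertonDyer.Theorems.SplitMultSfTransfer

open PowerSeries WeierstrassCurve NumberField IsDedekindDomain Field
  Literature.NumberTheory.GaloisRepresentations Literature.NumberTheory.EllipticCurves.GreenbergVatsal2000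
  Literature.NumberTheory.EllipticCurves Literature.NumberTheory.EllipticCurves.Rank1Residual
  Literature.NumberTheory.EllipticCurves.Castella2018 Literature.NumberTheory.EllipticCurves.GreenbergSelmer
  Literature.NumberTheory.QuadraticFields Literature.NumberTheory.EllipticCurves.KellerYin2024
  Literature.NumberTheory.EllipticCurves.IwasawaAlgebra Literature.NumberTheory.IwasawaTheory
  Literature.NumberTheory.IwasawaTheory.Greenberg2016 Literature.NumberTheory.IwasawaTheory.Greenberg2006
  Literature.NumberTheory.GaloisCohomology
  Summit.BirchSwinnertonDyer.Rank1Residual.X2.ResidualDevissageModules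
  Summit.BirchSwinnertonDyer.BirchSwinnertonDyer.Theorems

/-! ## §1. The «outside `S`» conditions are read off `p` only -/

section OffP

variable {K : Type} [Field K] [NumberField K] (H : Subgroup (absoluteGaloisGroup K)) [H.Normal]
  (M : Type) [AddCommGroup M] [DistribMulAction (absoluteGaloisGroup K) M] [TopologicalSpace M] [DiscreteTopology M]
  (p : ℕ) {S₀ S₁ : Set (HeightOneSpectrum (𝓞 K))}

/-- **`H¹(K_Σ/L, M)` depends on `S` only off `p`**: GV's `unramifiedOutside H M p S` imposes unramifiedness at the finite `w ∉ S` WITH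
`w ∤ p`; two sets agreeing at the places not over `p` give the same subgroup. [cite: GreenbergVatsal2000, §2 pp. 16, 23] -/
theorem unramifiedOutside_congr_offP (hS : ∀ w : HeightOneSpectrum (𝓞 K), ((p : ℕ) : 𝓞 K) ∉ w.asIdeal → (w ∈ S₀ ↔ w ∈ S₁)) :
    unramifiedOutside H M p S₀ = unramifiedOutside H M p S₁ := by
  ext c
  rw [mem_unramifiedOutside_iff, mem_unramifiedOutside_iff]
  exact ⟨fun h w hw hpw σ ↦ h w (fun h' ↦ hw ((hS w hpw).mp h')) hpw σ,
    fun h w hw hpw σ ↦ h w (fun h' ↦ hw ((hS w hpw).mpr h')) hpw σ⟩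

/-- **GV's `S^{S}_M(L)` depends on `S` only off `p`.** [cite: GreenbergVatsal2000, §2 pp. 16–17, 20, 23] -/
theorem datumSelmer_congr_offP (L : Data K M p)
    (hS : ∀ w : HeightOneSpectrum (𝓞 K), ((p : ℕ) : 𝓞 K) ∉ w.asIdeal → (w ∈ S₀ ↔ w ∈ S₁)) :
    datumSelmer H M p L S₀ = datumSelmer H M p L S₁ := by
  ext c
  rw [mem_datumSelmer_iff, mem_datumSelmer_iff, unramifiedOutside_congr_offP H M p hS]

/-- **GV's strict `S^{S,str}_M(L)` depends on `S` only off `p`.** [cite: GreenbergVatsal2000, §2 pp. 15, 20, 23] -/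
theorem datumStrictSelmer_congr_offP (L : Data K M p)
    (hS : ∀ w : HeightOneSpectrum (𝓞 K), ((p : ℕ) : 𝓞 K) ∉ w.asIdeal → (w ∈ S₀ ↔ w ∈ S₁)) :
    datumStrictSelmer H M p L S₀ = datumStrictSelmer H M p L S₁ := by
  ext c
  rw [mem_datumStrictSelmer_iff, mem_datumStrictSelmer_iff, unramifiedOutside_congr_offP H M p hS]

/-- **Castella's `Sel_𝔭^S(L, M)` depends on `S` only off `p`** (`AcSelmer.selmerOver`: «trivial at the chosen place above every finite
`v ∤ p` with `v ∉ S`»). [cite: Castella2018, Def. 2.2 (arXiv:1704.06608 p. 5)] -/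
theorem selmerOver_congr_offP (𝔭 : HeightOneSpectrum (𝓞 K))
    (hS : ∀ w : HeightOneSpectrum (𝓞 K), ((p : ℕ) : 𝓞 K) ∉ w.asIdeal → (w ∈ S₀ ↔ w ∈ S₁)) :
    AcSelmer.selmerOver H M p 𝔭 S₀ = AcSelmer.selmerOver H M p 𝔭 S₁ := by
  ext c
  rw [AcSelmer.mem_selmerOver_iff, AcSelmer.mem_selmerOver_iff]
  exact ⟨fun h ↦ ⟨fun w hpw hw σ ↦ h.1 w hpw (fun h' ↦ hw ((hS w hpw).mp h')) σ, h.2.1, h.2.2⟩,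
    fun h ↦ ⟨fun w hpw hw σ ↦ h.1 w hpw (fun h' ↦ hw ((hS w hpw).mpr h')) σ, h.2.1, h.2.2⟩⟩

end OffP

section OffPTower

variable {K : Type} [Field K] [NumberField K] {p : ℕ} [hp : Fact p.Prime] (κ : ZpExtension K p)
  {S₀ S₁ : Set (HeightOneSpectrum (𝓞 K))}

/-- **GV's `S^{S}_M(K_∞)` depends on `S` only off `p`.** [cite: GreenbergVatsal2000, §2 pp. 16–17, 20, 23] -/
theorem datumSelmerInfty_congr_offP (M : Type) [AddCommGroup M] [DistribMulAction (absoluteGaloisGroup K) M] [TopologicalSpace M]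
    [DiscreteTopology M] (L : Data K M p)
    (hS : ∀ w : HeightOneSpectrum (𝓞 K), ((p : ℕ) : 𝓞 K) ∉ w.asIdeal → (w ∈ S₀ ↔ w ∈ S₁)) :
    datumSelmerInfty κ M L S₀ = datumSelmerInfty κ M L S₁ := by
  rw [datumSelmerInfty_eq, datumSelmerInfty_eq]
  exact datumSelmer_congr_offP κ.kerSubgroup M p L hS

/-- **Castella's `Sel_𝔭^S(K_∞, E[p^∞])` depends on `S` only off `p`.** [cite: Castella2018, Def. 2.2 (arXiv:1704.06608 p. 5)] -/
theorem selmerAc_congr_offP (W : WeierstrassCurve K) (𝔭 : HeightOneSpectrum (𝓞 K))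
    (hS : ∀ w : HeightOneSpectrum (𝓞 K), ((p : ℕ) : 𝓞 K) ∉ w.asIdeal → (w ∈ S₀ ↔ w ∈ S₁)) :
    AcSelmer.selmerAc W p κ 𝔭 S₀ = AcSelmer.selmerAc W p κ 𝔭 S₁ :=
  selmerOver_congr_offP κ.kerSubgroup (W.geomPrimaryTorsion p) p 𝔭 hS

end OffPTower

/-! ## §2. Transfer of GV dual data along an equality of the non-primitive groups -/

section DualTransfer

variable {K : Type} [Field K] [NumberField K] {p : ℕ} [hp : Fact p.Prime] (κ : ZpExtension K p)
  {M : Type} [AddCommGroup M] [DistribMulAction (absoluteGaloisGroup K) M] [TopologicalSpace M]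
  [DiscreteTopology M] (L : Data K M p) {S₀ S₁ : Set (HeightOneSpectrum (𝓞 K))} {γ : absoluteGaloisGroup K}

/-- **Transfer of dual data along `S^{S₀}_M(K_∞) = S^{S₁}_M(K_∞)`**: every Pontryagin-dual datum `D` for `S₀` IS a dual datum for `S₁`
with the same `Λ`-module `D.X` (precompose `toDual` with the identification; `T` still acts as `conj_γ − 1`, constants through `ℤ_p → ℤ/p^k`),
hence any property of `Λ`-modules holding for the module of EVERY `S₁`-datum holds for `D.X`. (This seat's lineage's g8 pattern
`StrictEqUnramifiedCentral.prop_datumDualData_of_forall_grDualData`.) [cite: GreenbergVatsal2000, §2 p. 17] -/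
theorem prop_datumDualData_congr (h : datumSelmerInfty κ M L S₀ = datumSelmerInfty κ M L S₁)
    (P : ∀ (X : Type) [AddCommGroup X] [Module (IwasawaAlgebra p) X], Prop)
    (hP : ∀ D : DatumDualData κ γ M L S₁, P D.X) (D : DatumDualData κ γ M L S₀) : P D.X := by
  -- the two inclusions between the (equal) subgroups
  let e : ↥(datumSelmerInfty κ M L S₁) →+ ↥(datumSelmerInfty κ M L S₀) := AddSubgroup.inclusion h.ge
  let e' : ↥(datumSelmerInfty κ M L S₀) →+ ↥(datumSelmerInfty κ M L S₁) := AddSubgroup.inclusion h.le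
  have hee' : ∀ t, e (e' t) = t := fun t ↦
    Subtype.ext (by rw [AddSubgroup.coe_inclusion, AddSubgroup.coe_inclusion])
  have he'e : ∀ s, e' (e s) = s := fun s ↦
    Subtype.ext (by rw [AddSubgroup.coe_inclusion, AddSubgroup.coe_inclusion])
  let td : D.X →+ (datumSelmerInfty κ M L S₁ →+ AddCircle (1 : ℚ)) :=
    { toFun := fun x ↦ (D.toDual x).comp e
      map_zero' := by rw [map_zero, AddMonoidHom.zero_comp]
      map_add' := fun x y ↦ by rw [map_add, AddMonoidHom.add_comp] }
  have htd : ∀ x s, td x s = D.toDual x (e s) := fun _ _ ↦ rfl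
  have hbij : Function.Bijective td := by
    constructor
    · intro x y hxy
      apply D.bijective.1
      ext t
      rw [← hee' t, ← htd, ← htd, hxy]
    · intro χ
      obtain ⟨x, hx⟩ := D.bijective.2 (χ.comp e')
      refine ⟨x, ?_⟩
      ext s
      rw [htd, hx, AddMonoidHom.comp_apply, he'e]
  have hT : ∀ (x : D.X) (s : datumSelmerInfty κ M L S₁),
      td ((PowerSeries.X : IwasawaAlgebra p) • x) s =
        td x ⟨conjH1 κ.kerSubgroup M γ s, conjH1_mem_datumSelmer κ.kerSubgroup M p L S₁ γ s.2⟩ - td x s := by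
    intro x s
    have hes : (⟨conjH1 κ.kerSubgroup M γ (e s : datumSelmerInfty κ M L S₀),
        conjH1_mem_datumSelmer κ.kerSubgroup M p L S₀ γ (e s).2⟩ : datumSelmerInfty κ M L S₀) =
          e ⟨conjH1 κ.kerSubgroup M γ s, conjH1_mem_datumSelmer κ.kerSubgroup M p L S₁ γ s.2⟩ := Subtype.ext (by
      change conjH1 κ.kerSubgroup M γ ((e s : datumSelmerInfty κ M L S₀) : subgroupH1 κ.kerSubgroup M) = _
      rw [AddSubgroup.coe_inclusion, AddSubgroup.coe_inclusion])
    rw [htd, htd, htd, D.toDual_T_smul, hes]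
  have hC : ∀ (c : ℤ_[p]) (x : D.X) (s : datumSelmerInfty κ M L S₁) (k : ℕ), (p ^ k) • s = 0 →
      td (PowerSeries.C c • x) s = (PadicInt.toZModPow k c).val • td x s := by
    intro c x s k hk
    rw [htd, htd]
    exact D.toDual_C_smul c x (e s) k (by rw [← map_nsmul, hk, map_zero])
  exact hP { X := D.X, toDual := td, bijective := hbij, toDual_T_smul := hT, toDual_C_smul := hC }

/-- **Transfer of dual data along two imprimitivity sets agreeing off `p`.** [cite: GreenbergVatsal2000, §2 pp. 17, 20, 23] -/
theorem prop_datumDualData_congr_offP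
    (hS : ∀ w : HeightOneSpectrum (𝓞 K), ((p : ℕ) : 𝓞 K) ∉ w.asIdeal → (w ∈ S₀ ↔ w ∈ S₁))
    (P : ∀ (X : Type) [AddCommGroup X] [Module (IwasawaAlgebra p) X], Prop)
    (hP : ∀ D : DatumDualData κ γ M L S₁, P D.X) (D : DatumDualData κ γ M L S₀) : P D.X :=
  prop_datumDualData_congr κ L (datumSelmerInfty_congr_offP κ M L hS) P hP D

end DualTransfer

/-! ## §3. Transfer of Castella's dual `X_ac^S(E[p^∞])` along an equality of the Selmer groups -/

section XAcTransfer

variable {K : Type} [Field K] [NumberField K] (W : WeierstrassCurve K) (p : ℕ) [hp : Fact p.Prime]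
  (κ : ZpExtension K p) (𝔭 : HeightOneSpectrum (𝓞 K)) {S₀ S₁ : Set (HeightOneSpectrum (𝓞 K))}
  (γ : absoluteGaloisGroup K) [hγ : Fact (κ.IsTopGenerator γ)]

/-- Unfolding the `Λ`-action on `X_ac^S(E[p^∞])`: `f • x` is the `IsLocNil` action `smulFun f x` of `T = conj_γ − 1` (definitional;
Castella §2.2 «`1 + T ↦ γ`»). [cite: Castella2018, §2.2 (arXiv:1704.06608 p. 5)] -/
theorem xAc_smul_apply {S : Set (HeightOneSpectrum (𝓞 K))} (f : IwasawaAlgebra p) (x : AcSelmer.XAc W p κ 𝔭 S γ)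
    (s : ↥(AcSelmer.selmerAc W p κ 𝔭 S)) :
    (f • x) s = (AcSelmer.isLocNil_conjSelmerAc_sub_one W p κ 𝔭 S hγ.out).smulFun f
      (x : ↥(AcSelmer.selmerAc W p κ 𝔭 S) →+ AddCircle (1 : ℚ)) s :=
  rfl

omit hγ in
/-- **The identification of the groups intertwines the two `T`-operators** `conj_γ − 1` on `Sel_𝔭^{S₁}` and on `Sel_𝔭^{S₀}` (and their
powers): both are restrictions of `conj_γ − 1` on `H¹(K_∞, E[p^∞])`. [cite: Castella2018, §2.1–2.2 (arXiv:1704.06608 p. 5)] -/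
theorem conjSub_pow_inclusion (h : AcSelmer.selmerAc W p κ 𝔭 S₀ = AcSelmer.selmerAc W p κ 𝔭 S₁) (i : ℕ)
    (t : ↥(AcSelmer.selmerAc W p κ 𝔭 S₁)) :
    ((AcSelmer.conjSelmerAc W p κ 𝔭 S₀ γ - 1) ^ i) (AddSubgroup.inclusion h.ge t) =
      AddSubgroup.inclusion h.ge (((AcSelmer.conjSelmerAc W p κ 𝔭 S₁ γ - 1) ^ i) t) := by
  have hψ : ∀ t, (AcSelmer.conjSelmerAc W p κ 𝔭 S₀ γ - 1) (AddSubgroup.inclusion h.ge t) =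
      AddSubgroup.inclusion h.ge ((AcSelmer.conjSelmerAc W p κ 𝔭 S₁ γ - 1) t) :=
    fun t ↦ by
    apply Subtype.ext
    simp only [IwasawaDual.End_sub_apply, AddMonoid.End.one_apply, map_sub, AddSubgroupClass.coe_sub,
      AcSelmer.coe_conjSelmerAc_apply, AddSubgroup.coe_inclusion]
  induction i generalizing t with
  | zero => rw [pow_zero, pow_zero, AddMonoid.End.one_apply, AddMonoid.End.one_apply]
  | succ i ih =>
    rw [pow_succ, pow_succ, AddMonoid.End.coe_mul, AddMonoid.End.coe_mul, Function.comp_apply, Function.comp_apply, hψ, ih]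

/-- Values of the precomposition map `X_ac^{S₀} → X_ac^{S₁}`, `x ↦ x ∘ ι` (stated through the `S₁`-side coercion and `comp_apply`: a
direct `rfl` against `x (ι s)` makes the kernel compare `X_ac^{S₁}` with `X_ac^{S₀}` and time out — cf. this lineage's g7
`XAcImprimitiveLambdaShift.exists_restrict`). [folklore] -/
theorem apply_comp_inclusion {A B : Set (HeightOneSpectrum (𝓞 K))} (hAB : AcSelmer.selmerAc W p κ 𝔭 B ≤ AcSelmer.selmerAc W p κ 𝔭 A)
    (x : AcSelmer.XAc W p κ 𝔭 A γ) (s : ↥(AcSelmer.selmerAc W p κ 𝔭 B)) :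
    (show AcSelmer.XAc W p κ 𝔭 B γ from
        (x : ↥(AcSelmer.selmerAc W p κ 𝔭 A) →+ AddCircle (1 : ℚ)).comp (AddSubgroup.inclusion hAB)) s =
      x (AddSubgroup.inclusion hAB s) :=
  (rfl : _ = ((x : ↥(AcSelmer.selmerAc W p κ 𝔭 A) →+ AddCircle (1 : ℚ)).comp (AddSubgroup.inclusion hAB)) s).trans
    (AddMonoidHom.comp_apply _ _ _)

/-- **Precomposition with the identification is `Λ`-linear** (pointwise form): for `x ∈ X_ac^{S₀} = Hom(Sel_𝔭^{S₀}, ℚ/ℤ)`, `f ∈ Λ` and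
`s ∈ Sel_𝔭^{S₁}`, `(f • x)(ι s) = (f • (x ∘ ι))(s)` — the action of `f` is the truncated sum `Σ_{i<N} f_i · x((conj_γ − 1)^i s)`
(`IwasawaDual.evalT`) on both sides, and `ι` intertwines the operators (`conjSub_pow_inclusion`). [cite: Castella2018, §2.2 (arXiv:1704.06608 p. 5)]
[cite: GreenbergLNM1716, §1 (after Conj. 1.3)] [cite: Lang1990, Ch. 5 §1] -/
theorem smul_apply_inclusion_eq (h : AcSelmer.selmerAc W p κ 𝔭 S₀ = AcSelmer.selmerAc W p κ 𝔭 S₁) (f : IwasawaAlgebra p)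
    (x : AcSelmer.XAc W p κ 𝔭 S₀ γ) (s : ↥(AcSelmer.selmerAc W p κ 𝔭 S₁)) :
    (f • x) (AddSubgroup.inclusion h.ge s) =
      (f • (show AcSelmer.XAc W p κ 𝔭 S₁ γ from
        (x : ↥(AcSelmer.selmerAc W p κ 𝔭 S₀) →+ AddCircle (1 : ℚ)).comp (AddSubgroup.inclusion h.ge))) s := by
  have h₀ : IwasawaDual.IsLocNil p (AcSelmer.conjSelmerAc W p κ 𝔭 S₀ γ - 1) :=
    AcSelmer.isLocNil_conjSelmerAc_sub_one W p κ 𝔭 S₀ hγ.out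
  have h₁ : IwasawaDual.IsLocNil p (AcSelmer.conjSelmerAc W p κ 𝔭 S₁ γ - 1) :=
    AcSelmer.isLocNil_conjSelmerAc_sub_one W p κ 𝔭 S₁ hγ.out
  obtain ⟨N, hN⟩ := h₁.nil s
  obtain ⟨k, hk⟩ := h₁.torsion s
  have hN' : ((AcSelmer.conjSelmerAc W p κ 𝔭 S₀ γ - 1) ^ N) (AddSubgroup.inclusion h.ge s) = 0 := by
    rw [conjSub_pow_inclusion W p κ 𝔭 γ h, hN, map_zero]
  have hk' : p ^ k • AddSubgroup.inclusion h.ge s = 0 := by rw [← map_nsmul, hk, map_zero]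
  rw [xAc_smul_apply, xAc_smul_apply, h₀.smulFun_apply f _ hN' hk', h₁.smulFun_apply f _ hN hk, IwasawaDual.evalT_def,
    IwasawaDual.evalT_def]
  exact Finset.sum_congr rfl fun i _ ↦ by rw [conjSub_pow_inclusion W p κ 𝔭 γ h]; rfl

/-- **`X_ac^{S₀}(E[p^∞]) ≃_Λ X_ac^{S₁}(E[p^∞])` along `Sel_𝔭^{S₀}(K_∞, E[p^∞]) = Sel_𝔭^{S₁}(K_∞, E[p^∞])`.** Both duals are the character group
of the SAME subgroup of `H¹(K_∞, E[p^∞])` with the `Λ = ℤ_p⟦T⟧`-structure `T = conj_γ − 1` of `IwasawaDual.IsLocNil.module` (Castella §2.2,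
`1 + T ↦ γ`): precomposition with the identity of the group is an additive bijection (inverse: precomposition with the inverse
identity), `Λ`-LINEAR by `smul_apply_inclusion_eq`. [cite: Castella2018, §2.2 (arXiv:1704.06608 p. 5)] [cite: GreenbergLNM1716, §1 (after Conj. 1.3)]
[cite: Lang1990, Ch. 5 §1] -/
theorem nonempty_linearEquiv_xAc_of_selmerAc_eq (h : AcSelmer.selmerAc W p κ 𝔭 S₀ = AcSelmer.selmerAc W p κ 𝔭 S₁) :
    Nonempty (AcSelmer.XAc W p κ 𝔭 S₀ γ ≃ₗ[IwasawaAlgebra p] AcSelmer.XAc W p κ 𝔭 S₁ γ) := by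
  have hee' : ∀ t : ↥(AcSelmer.selmerAc W p κ 𝔭 S₀), AddSubgroup.inclusion h.ge (AddSubgroup.inclusion h.symm.ge t) = t :=
    fun t ↦ Subtype.ext (by rw [AddSubgroup.coe_inclusion, AddSubgroup.coe_inclusion])
  have he'e : ∀ s : ↥(AcSelmer.selmerAc W p κ 𝔭 S₁), AddSubgroup.inclusion h.symm.ge (AddSubgroup.inclusion h.ge s) = s :=
    fun s ↦ Subtype.ext (by rw [AddSubgroup.coe_inclusion, AddSubgroup.coe_inclusion])
  let Fl : AcSelmer.XAc W p κ 𝔭 S₀ γ →ₗ[IwasawaAlgebra p] AcSelmer.XAc W p κ 𝔭 S₁ γ :=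
    { toFun := fun x : AcSelmer.XAc W p κ 𝔭 S₀ γ ↦ show AcSelmer.XAc W p κ 𝔭 S₁ γ from
        (x : ↥(AcSelmer.selmerAc W p κ 𝔭 S₀) →+ AddCircle (1 : ℚ)).comp (AddSubgroup.inclusion h.ge)
      map_add' := fun _ _ ↦ DFunLike.ext _ _ fun _ ↦ rfl
      map_smul' := fun f x ↦ DFunLike.ext _ _ fun s ↦ by
        rw [apply_comp_inclusion, RingHom.id_apply]
        exact smul_apply_inclusion_eq W p κ 𝔭 γ h f x s }
  have hFl : ∀ (x : AcSelmer.XAc W p κ 𝔭 S₀ γ) (s : ↥(AcSelmer.selmerAc W p κ 𝔭 S₁)),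
      Fl x s = x (AddSubgroup.inclusion h.ge s) := fun x s ↦
    apply_comp_inclusion W p κ 𝔭 γ h.ge x s
  refine ⟨LinearEquiv.ofBijective Fl ⟨fun x y hxy ↦ DFunLike.ext _ _ fun t ↦ ?_, fun χ ↦ ?_⟩⟩
  · have h1 := DFunLike.congr_fun hxy (AddSubgroup.inclusion h.symm.ge t)
    rw [hFl, hFl, hee'] at h1
    exact h1
  · refine ⟨show AcSelmer.XAc W p κ 𝔭 S₀ γ from
      (χ : ↥(AcSelmer.selmerAc W p κ 𝔭 S₁) →+ AddCircle (1 : ℚ)).comp (AddSubgroup.inclusion h.symm.ge),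
      DFunLike.ext _ _ fun s ↦ ?_⟩
    rw [hFl, apply_comp_inclusion, he'e]

/-- **Transfer of the invariants of `X_ac^S(E[p^∞])` along `Sel_𝔭^{S₀} = Sel_𝔭^{S₁}`**: finite generation and `Λ`-torsion pass from `S₀` to
`S₁`, and `μ`, `λ` are equal (`Module.Finite.equiv`, `isTorsion_of_injective`, `muInvariant_eq_of_linearEquiv`,
`lambdaInvariant_eq_of_linearEquiv` at §'s `Λ`-linear isomorphism). [cite: Castella2018, §2.2 (arXiv:1704.06608 p. 5)] [cite: Washington1997, §13.2] -/
theorem xAc_invariants_congr (h : AcSelmer.selmerAc W p κ 𝔭 S₀ = AcSelmer.selmerAc W p κ 𝔭 S₁) :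
    (Module.Finite (IwasawaAlgebra p) (AcSelmer.XAc W p κ 𝔭 S₀ γ) → Module.Finite (IwasawaAlgebra p) (AcSelmer.XAc W p κ 𝔭 S₁ γ)) ∧
    (Module.IsTorsion (IwasawaAlgebra p) (AcSelmer.XAc W p κ 𝔭 S₀ γ) →
      Module.IsTorsion (IwasawaAlgebra p) (AcSelmer.XAc W p κ 𝔭 S₁ γ)) ∧
    muInvariant p (AcSelmer.XAc W p κ 𝔭 S₀ γ) = muInvariant p (AcSelmer.XAc W p κ 𝔭 S₁ γ) ∧
    lambdaInvariant p (AcSelmer.XAc W p κ 𝔭 S₀ γ) = lambdaInvariant p (AcSelmer.XAc W p κ 𝔭 S₁ γ) := by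
  obtain ⟨e⟩ := nonempty_linearEquiv_xAc_of_selmerAc_eq W p κ 𝔭 γ h
  exact ⟨fun hfg ↦ Module.Finite.equiv e,
    fun htor ↦ Literature.NumberTheory.EllipticCurves.isTorsion_of_injective e.symm.toLinearMap e.symm.injective htor,
    muInvariant_eq_of_linearEquiv e, lambdaInvariant_eq_of_linearEquiv e⟩

end XAcTransfer

end Summit.BirchSwinnertonDyer.BirchSwinnertonDyer.Theorems.SplitMultSfTransfer

end
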